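/-
Copyright: derived here (Resolution Observatory cell `pub-rosobs`, carver gen 58). AI-written Lean; AI review is weaker than expert
review.  The FROBENIUS-ROW step of engine 1's THEOREM B″ (THEOREM-LT-eng1-g38 §11): "`Σ aᵢ ℓᵢ^p = 0` with the `ℓᵢ` independent linear
forms forces `aᵢ = 0` — entrywise Frobenius preserves the rank of the coefficient matrix" (proved here over a perfect field, and in
general conditionally on the independence of the Frobenius rows).  Instrument — NOT a resolution theorem and NOT a statement about the
invariant of [AbramovichTemkinWlodarczyk2024].
-/
import Mathlib.LinearAlgebra.LinearIndependent.Lemmas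
import Mathlib.FieldTheory.Perfect
import Mathlib.RingTheory.MvPolynomial.Basic
import Mathlib.Algebra.CharP.Lemmas
import Literature.AlgebraicGeometry.Resolution.DiffStableTriangular
import HarnessLib

/-!
# `p`-th powers of independent linear forms (THEOREM B″: "`c ≠ 0`")

Uniform value line: INSTRUMENT — elementary algebra for engine 1's THEOREM B″ in the cell's polynomial weighted-centre model `W(f)`;
NOT a resolution theorem, NOT a statement about the Abramovich–Temkin–Włodarczyk invariant, NOT summit progress; AI-written Lean, AI
review is weaker than expert review.

## Dictionary (THEOREM-LT §11, proof of THEOREM B″ ↔ this file)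

The engine: "`c ≠ 0`: else `Σ aᵢℓᵢ^p = 0`, and the `p`-th powers of independent linear forms are independent (entrywise Frobenius
preserves the rank of the coefficient matrix), so `aᵢ = 0`."  With `ℓᵢ = Σ_j c i j · X_j` (coefficient rows `c i : n → K`):
* `sum_C_mul_linearForm_pow` — `Σᵢ aᵢ ℓᵢ^p = Σ_j (Σᵢ aᵢ (c i j)^p) X_j^p` (Frobenius additivity);
* the monomials `X_j^p` are independent — reused from the tree: `Resolution.sum_C_mul_X_pow_eq_zero_iff`
  (`DiffStableTriangular.lean`);
* `eq_zero_of_sum_C_mul_linearForm_pow_eq_zero` — if the FROBENIUS ROWS `j ↦ (c i j)^p` are linearly independent then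
  `Σ aᵢ ℓᵢ^p = 0 ⇒ a = 0` (any field of exponential characteristic `p`);
* `linearIndependent_frobeniusRow` — over a PERFECT field the Frobenius rows of independent rows are independent (Mathlib's
  `LinearIndependent.map_of_surjective_injective` along the surjective Frobenius, entrywise map `RingHom.compLeft`), whence the unconditional perfect-field form
  `eq_zero_of_sum_C_mul_linearForm_pow_eq_zero_of_perfectRing`.  (A `Fin m`-indexed perfect-field independence lemma of the
  same content exists in a summit Theorems file, `Summit.Langlands…PhantomRMTransportFrobenius.linearIndependent_frobenius_comp`, which
  Literature cannot import; the version here is index-generic and phrased with `(c i j)^p`.)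
The general-field rank statement (Frobenius is an injective field endomorphism, and rank is insensitive to the ground field) is NOT
formalised here; COR B‴ / THEOREM B⁗ of the engine assume `k` perfect anyway.

References: engine 1, THEOREM-LT-eng1-g38 §11; Frobenius / perfect fields [Lang2002, Ch. V §6, Ch. VII §7]; context
[AbramovichTemkinWlodarczyk2024] §5.  Statements elementary; formalisation ours.
-/

open MvPolynomial

namespace Literature.AlgebraicGeometry.Resolution.WeightedBlowup

namespace FrobeniusForms

variable {K : Type*} [Field K] (p : ℕ) [ExpChar K p]

/-- Over a perfect field, entrywise Frobenius preserves linear independence of coefficient rows ("preserves the rank of the coefficient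
matrix"; ours via `LinearIndependent.map_of_surjective_injective`). [cite: Lang2002, Ch. V §6] -/
theorem linearIndependent_frobeniusRow [PerfectRing K p] {r n : Type*} (c : r → n → K) (hc : LinearIndependent K c) :
    LinearIndependent K (fun i j => c i j ^ p) := by
  -- entrywise Frobenius on rows, `Mathlib`'s `RingHom.compLeft`, as an additive map
  have h := hc.map_of_surjective_injective (frobenius K p) ((frobenius K p).compLeft n).toAddMonoidHom
    (surjective_frobenius K p) ?_ ?_
  · have e : (fun i j => c i j ^ p) = ⇑((frobenius K p).compLeft n).toAddMonoidHom ∘ c := by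
      funext i j
      simp [frobenius_def]
    rw [e]
    exact h
  · intro m hm
    funext j
    have hj := congrFun hm j
    simp only [RingHom.toAddMonoidHom_eq_coe, AddMonoidHom.coe_coe, RingHom.compLeft_apply, Function.comp_apply,
      frobenius_def, Pi.zero_apply] at hj
    exact pow_eq_zero_iff (expChar_pos K p).ne' |>.mp hj
  · intro a m
    funext j
    simp [frobenius_def, mul_pow]

/-- Frobenius additivity on a linear combination of `p`-th powers of linear forms (ours):
`Σᵢ aᵢ (Σ_j c i j X_j)^p = Σ_j (Σᵢ aᵢ (c i j)^p) X_j^p`. [cite: Lang2002, Ch. V §6] -/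
theorem sum_C_mul_linearForm_pow {r n : Type*} [Fintype r] [Fintype n] (a : r → K) (c : r → n → K) :
    (∑ i, C (a i) * (∑ j, C (c i j) * X j) ^ p : MvPolynomial n K) = ∑ j, C (∑ i, a i * c i j ^ p) * X j ^ p := by
  have hrow : ∀ i, ((∑ j, C (c i j) * X j) ^ p : MvPolynomial n K) = ∑ j, C (c i j ^ p) * X j ^ p := by
    intro i
    rw [sum_pow_char]
    refine Finset.sum_congr rfl fun j _ => ?_
    rw [mul_pow, C_pow]
  simp_rw [hrow, Finset.mul_sum, map_sum, Finset.sum_mul]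
  rw [Finset.sum_comm]
  refine Finset.sum_congr rfl fun j _ => Finset.sum_congr rfl fun i _ => ?_
  rw [C_mul, mul_assoc]

/-- **THEOREM B″, "`c ≠ 0`" step** (conditional form, any field; ours): if the Frobenius rows `j ↦ (c i j)^p` are linearly
independent, then `Σᵢ aᵢ ℓᵢ^p = 0` (with `ℓᵢ = Σ_j c i j X_j`) forces `a = 0`. [cite: Lang2002, Ch. V §6] -/
theorem eq_zero_of_sum_C_mul_linearForm_pow_eq_zero {r n : Type*} [Fintype r] [Fintype n] (a : r → K) (c : r → n → K)
    (hc : LinearIndependent K (fun i j => c i j ^ p))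
    (h : (∑ i, C (a i) * (∑ j, C (c i j) * X j) ^ p : MvPolynomial n K) = 0) : a = 0 := by
  rw [sum_C_mul_linearForm_pow] at h
  have hβ := (sum_C_mul_X_pow_eq_zero_iff _ (expChar_pos K p)).mp h
  have hsum : ∑ i, a i • (fun j => c i j ^ p) = 0 := by
    funext j
    simpa [Finset.sum_apply, Pi.smul_apply, smul_eq_mul] using hβ j
  funext i
  exact Fintype.linearIndependent_iff.mp hc a hsum i

/-- **THEOREM B″, "`c ≠ 0`" step over a perfect field** (ours): independent coefficient rows and `Σᵢ aᵢ ℓᵢ^p = 0` force `a = 0`.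
[cite: Lang2002, Ch. V §6] -/
theorem eq_zero_of_sum_C_mul_linearForm_pow_eq_zero_of_perfectRing [PerfectRing K p] {r n : Type*} [Fintype r] [Fintype n]
    (a : r → K) (c : r → n → K) (hc : LinearIndependent K c)
    (h : (∑ i, C (a i) * (∑ j, C (c i j) * X j) ^ p : MvPolynomial n K) = 0) : a = 0 :=
  eq_zero_of_sum_C_mul_linearForm_pow_eq_zero p a c (linearIndependent_frobeniusRow p c hc) h

end FrobeniusForms

end Literature.AlgebraicGeometry.Resolution.WeightedBlowup
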